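import Mathlib.Analysis.SpecialFunctions.Log.Deriv
import Mathlib.Analysis.SpecialFunctions.ExpDeriv
import Mathlib.Algebra.BigOperators.Field
import Literature.ComputerArithmetic.Higham2002.Summation
import HarnessLib

/-!
# Blanchard–Higham–Higham 2021: rounding error analysis of the log-sum-exp and softmax
# algorithms (Theorems 3.2, 3.3, 3.4, 4.2, 4.3, 4.4) typed and PROVED in exact model form

HONEST FRAMING: shared numerical engines serving client cells; rigour lives in the verifiers; every
published number belongs to a client cell's ledger, not to the engines group. Kernels lane: this file
types the accuracy of compiled `exp`/`log` expression kernels (unshifted and max-shifted log-sum-exp,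
softmax with and without division) with the errors of the elementary-function library as HYPOTHESES
(`|δ| ≤ u` per operation, exactly the source's assumption (b) of §3); no format, hardware or library
claim is made here.

Source: P. Blanchard, D. J. Higham, N. J. Higham, *Accurately computing the log-sum-exp and softmax
functions*, IMA J. Numer. Anal. 41(4) (2021) 2311–2330, doi:10.1093/imanum/draa038
[cite: BlanchardHighamHigham2021] (= arXiv:1909.03469, whose source text carries the displayed
formulas; the published text fixes the numbering used below: eqs. (1.1)–(1.6), (2.2), Algorithm 3.1,
(3.1), (3.3), Theorem 3.2 = (3.5), Theorem 3.3 = (3.6), (3.7)–(3.10), Theorem 3.4 = (3.11),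
Algorithm 4.1, (4.1)–(4.9), Theorem 4.2 = (4.10), Theorem 4.3 = (4.11), Theorem 4.4 = (4.12)).

ENCODING (ours, marked as such in each docstring).
* Data `x₀, …, x_{n−1} : ℝ` as `x : ℕ → ℝ` read on `range n`; `expSum x n = Σ e^{xᵢ}`,
  `lse x n = log Σ e^{xᵢ}` (1.1), `softmax x n j = e^{xⱼ}/Σ e^{xᵢ}` (1.2).
* Rounding-error counters on the LOGARITHMIC scale: `LogAcc Λ a â :⇔ e^{−Λ}a ≤ â ≤ e^{Λ}a` and the
  unit `logErr u = −log(1−u)` (`u ≤ logErr u ≤ u/(1−u)`): one operation in the standard model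
  `fl(a∘b) = (a∘b)(1+δ)`, `|δ| ≤ u`, costs one unit (`LogAcc.one_add`), products/quotients add the
  counters (`LogAcc.mul/div`), sums keep the maximum (`LogAcc.sum`), and `m` units convert back to
  the familiar relative bound `e^{m·logErr u} − 1 = (1−u)^{−m} − 1 ≤ γₘ = mu/(1−mu)`
  (`exp_natMul_logErr_sub_one_le_gamma`, from the tree's `Higham2002.inv_one_sub_pow_sub_one_le_gamma`).
  This is Higham's `(1+θₖ)`, `|θₖ| ≤ γₖ` bookkeeping [Higham2002ASNA, Lemmas 3.1, 3.3] in a form in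
  which every bound below is an EXACT inequality (no `O(u²)`), from which the printed first-order
  constants are read off (`le_exp_sub_one`, `exp_sub_one_le_div`: `Λ ≤ e^Λ − 1 ≤ Λ/(1−Λ)`).
* The summation loop of Algorithms 3.1/4.1 (`s = 0; for i: s = s + wᵢ`, first assignment exact) is
  `flSum w ε m` = the tree's `Higham2002.recSum` shifted by one (`flSum_succ_eq_recSum`); for
  nonnegative terms it is log-accurate with `m − 1` units for `m` terms (`logAcc_flSum_succ`) — the
  source's "|Δs| ≤ (n−1)u·s + O(u²)" step inside the proof of (3.3).
* Algorithm 3.1: `ŵᵢ = e^{xᵢ}(1+δᵢ)` (3.1), `ŝ = flSum ŵ ε n`, `ŷ = log(ŝ)(1+τ)`,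
  `ĝⱼ = (ŵⱼ/ŝ)(1+ζⱼ)`; the division-free formula (3.7)/(1.5) `ĝⱼ = exp((xⱼ − ŷ)(1+κⱼ))(1+νⱼ)`.
* Algorithm 4.1 with the maximal entry placed LAST ("Assuming for notational simplicity that k = n",
  proof of Theorem 4.2): data `x₀, …, x_N` (so `n = N + 1`), `a = x_N = max`, hypotheses
  `|xᵢ − x_N| ≤ D` for `i < N` (any `D ≥ x_max − x_min` will do); `s = Σ_{i<N} e^{xᵢ−a}` (4.4),
  `ĉᵢ = (xᵢ − a)(1+σᵢ)`, `ŵᵢ = e^{ĉᵢ}(1+δᵢ)`, `ŝ = flSum ŵ ε N`, `ŷ = (a + log(1+ŝ)(1+τ₃))(1+τ₄)`,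
  `ĝⱼ = (ŵⱼ / ((1+ŝ)(1+τ₅)))(1+ζⱼ)`.

**What is proved** (`0 ≤ u < 1`; `ℓ := logErr u`).
* Exact facts: (1.2) softmax is the gradient of log-sum-exp (`hasDerivAt_lse`); (1.3)/(1.4) shift
  invariance (`lse_shift`, `softmax_shift`); (1.5) `gⱼ = exp(xⱼ − y)` (`softmax_eq_exp_sub_lse`);
  (4.1) `y = x_max + log(1 + s)` (`lse_eq_max_add_log_one_add`); (4.2) `x_max ≤ y ≤ x_max + log n`
  (`le_lse`, `lse_le`); (4.3) `|y − xⱼ| ≤ |x_max − xⱼ| + log n` (`abs_lse_sub_le`); `Σ gⱼ = 1`,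
  `0 < gⱼ ≤ 1`, `‖g‖_∞ ≥ 1/n` (`sum_softmax`, `softmax_le_one`, `inv_le_softmax_max`); the row sums of
  the softmax Jacobian `G = diag(g) − ggᵀ` of §2 are `2gᵢ(1−gᵢ) ≤ 1`, i.e. `‖G‖_∞ ≤ 1`
  (`sum_abs_softmaxJac`, `sum_abs_softmaxJac_le_one`).
* (3.3): `LogAcc (n·ℓ) s ŝ`, hence `|ŝ − s| ≤ ((1−u)^{−n} − 1)s ≤ γₙ s` (`logAcc_sHat`,
  `abs_sHat_sub_le_gamma`; printed: `(n+1)u + O(u²)` — the source majorises its per-term coefficients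
  `n + 2 − i` by `n + 1`, whose sharp maximum is `n`; ours is `n u + O(u²)` and implies the printed bound).
* **THEOREM 3.2** exact: `|y − ŷ| ≤ u|y| + (1+u)·n·ℓ` (`abs_lse_sub_lseHat_le`), i.e.
  `|y − ŷ|/|y| ≤ u + (1+u)nℓ/|y|` (`abs_lse_sub_lseHat_div_le`) = `(1 + n/|y|)u + O(u²)`, implying the
  printed (3.5) `(1 + (n+1)/|y|)u + O(u²)`.
* **THEOREM 3.3** exact: `LogAcc ((n+2)ℓ) gⱼ ĝⱼ` (`logAcc_softmaxHat`), hence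
  `|ĝⱼ − gⱼ| ≤ ((1−u)^{−(n+2)} − 1)gⱼ ≤ γ_{n+2} gⱼ ≤ γ_{n+2}‖g‖_∞` (`abs_softmaxHat_sub_le`,
  `abs_softmaxHat_sub_le_gamma`, `…_norm`) = the printed (3.6) `(n+3)u + O(u²)` sharpened by one unit.
* **THEOREM 3.4** exact, for ANY approximation `ŷ` of `y`:
  `LogAcc (|xⱼ − y|u + (1+u)|y − ŷ| + ℓ) gⱼ ĝⱼ` for the division-free formula (`logAcc_softmaxAltHat`);
  with Theorem 3.2's `ŷ` this is `(1 + |xⱼ − y| + |y| + n)u + O(u²)` (`logAcc_softmaxAltHat_basic`,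
  printed (3.11): `(|y| + max|xⱼ − y| + n + 2)u`).
* (4.6)/(4.7): `LogAcc (D·u + N·ℓ) s ŝ` for the shifted sum (`logAcc_sHatS`; printed `(n + D)u`,
  `n = N + 1`).
* **THEOREM 4.2** exact, with the `s ≪ 1` refinement (4.8) built in:
  `|y − ŷ| ≤ u|y| + u(1+u)·log(1+s) + (1+u)²·(s/(1+s))·(e^{Du+Nℓ} − 1)` (`abs_lse_sub_lseHatS_le`);
  since `log(1+s) = y − x_max` and `s/(1+s) ≤ 1` this gives
  `|y − ŷ| ≤ u|y| + u(1+u)(y − x_max) + (1+u)²(e^{Du+Nℓ} − 1)` (`abs_lse_sub_lseHatS_le'`) =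
  `(|y| + (y − x_max) + D + N)u + O(u²) = (|y| + |y + n − 1 − x_min|)u + O(u²)` at `D = x_max − x_min`;
  the printed (4.10) `|(y + n − x_min)/y|u` drops the final-addition error `δ₄` ("For simplicity, we
  will ignore δ₄"), which is the `u|y|` here.
* **THEOREM 4.3** exact: `LogAcc (2Du + (N+3)ℓ) gⱼ ĝⱼ` (`logAcc_softmaxHatS`), hence
  `|ĝⱼ − gⱼ| ≤ (e^{2Du}(1−u)^{−(N+3)} − 1)gⱼ` (`abs_softmaxHatS_sub_le`) = `(n + 2 + 2D)u + O(u²)`, the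
  printed (4.11) `(n + 2 + 2(x_max − x_min))u`.
* **THEOREM 4.4** exact: Theorem 3.4's general statement at the shifted `ŷ`
  (`logAcc_softmaxAltHat_shifted`), first order `(1 + |xⱼ − y| + |y| + (y − x_max) + D + N)u`, cf. the
  printed (4.12) `(1 + max|xⱼ − y| + |y + n − x_min|)u`.

NOT typed here: the condition numbers of §2 ((2.2)–(2.6) are definitions and limits, no theorem is
stated); the overflow/underflow discussion and Tables of §1/§4 (format-dependent); §5 (experiments);
the remark after Theorem 3.3 that `n` may be replaced by `√n` under probabilistic rounding assumptions
(the tree's probabilistic bounds are `ConnollyHighamMary2021.*`, `HighamMary2019`-type files); the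
partial derivatives `∂gᵢ/∂xⱼ` as derivatives (only their closed form enters `softmaxJac`).
-/

namespace Literature.ComputerArithmetic.BlanchardHighamHigham2021

open Finset

noncomputable section

/-! ### §0 Rounding-error counters on the logarithmic scale (ENCODING, ours) -/

/-- The log-scale unit of one rounding error: `logErr u = −log(1 − u) = log(1/(1−u))`, so that
`|δ| ≤ u` gives `e^{−logErr u} = 1 − u ≤ 1 + δ ≤ 1/(1−u) = e^{logErr u}`. ENCODING (ours) of the
`(1+δ)`, `|δ| ≤ u` factors of the standard model. [cite: BlanchardHighamHigham2021, §3 assumption (b)] -/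
def logErr (u : ℝ) : ℝ := -Real.log (1 - u)

/-- `e^{logErr u} = (1−u)⁻¹`. [cite: BlanchardHighamHigham2021, §3 assumption (b)] -/
theorem exp_logErr {u : ℝ} (hu1 : u < 1) : Real.exp (logErr u) = (1 - u)⁻¹ := by
  rw [logErr, Real.exp_neg, Real.exp_log (by linarith)]

/-- `e^{−logErr u} = 1−u`. [cite: BlanchardHighamHigham2021, §3 assumption (b)] -/
theorem exp_neg_logErr {u : ℝ} (hu1 : u < 1) : Real.exp (-logErr u) = 1 - u := by
  rw [logErr, neg_neg, Real.exp_log (by linarith)]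

/-- `0 ≤ logErr u` for `0 ≤ u < 1`. [cite: BlanchardHighamHigham2021, §3 assumption (b)] -/
theorem logErr_nonneg {u : ℝ} (hu : 0 ≤ u) (hu1 : u < 1) : 0 ≤ logErr u := by
  have h := Real.log_le_sub_one_of_pos (show (0 : ℝ) < 1 - u by linarith)
  rw [logErr]; linarith

/-- `u ≤ logErr u` (`log(1−u) ≤ −u`). [cite: BlanchardHighamHigham2021, §3 assumption (b)] -/
theorem le_logErr {u : ℝ} (hu1 : u < 1) : u ≤ logErr u := by
  have h := Real.log_le_sub_one_of_pos (show (0 : ℝ) < 1 - u by linarith)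
  rw [logErr]; linarith

/-- `logErr u ≤ u/(1−u)` (`log t ≤ t − 1` at `t = 1/(1−u)`): one log-unit is `u + O(u²)`.
[cite: BlanchardHighamHigham2021, §3 assumption (b)] -/
theorem logErr_le {u : ℝ} (hu1 : u < 1) : logErr u ≤ u / (1 - u) := by
  have h1u : (0 : ℝ) < 1 - u := by linarith
  have h := Real.log_le_sub_one_of_pos (inv_pos.mpr h1u)
  rw [Real.log_inv] at h
  have heq : (1 - u)⁻¹ - 1 = u / (1 - u) := by
    rw [inv_eq_one_div, div_sub_one h1u.ne']
    congr 1
    ring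
  rw [logErr]; linarith

/-- `m` log-units: `e^{m·logErr u} = (1−u)^{−m}`. [cite: BlanchardHighamHigham2021, §3 eq. (3.3)] -/
theorem exp_natMul_logErr {u : ℝ} (hu1 : u < 1) (m : ℕ) :
    Real.exp (m * logErr u) = ((1 - u) ^ m)⁻¹ := by
  rw [Real.exp_nat_mul, exp_logErr hu1, inv_pow]

/-- `m` log-units in Higham's `γ` form: `e^{m·logErr u} − 1 = (1−u)^{−m} − 1 ≤ γₘ = mu/(1 − mu)`
(`mu < 1`). [cite: Higham2002ASNA, Lemma 3.1] -/
theorem exp_natMul_logErr_sub_one_le_gamma {u : ℝ} (hu1 : u < 1) {m : ℕ} (hm : (m : ℝ) * u < 1) :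
    Real.exp (m * logErr u) - 1 ≤ Higham2002.gamma u m := by
  rw [exp_natMul_logErr hu1]
  exact Higham2002.inv_one_sub_pow_sub_one_le_gamma hu1 hm

/-- `m·logErr u ≤ mu/(1−u)`. [cite: BlanchardHighamHigham2021, §3 assumption (b)] -/
theorem natMul_logErr_le {u : ℝ} (hu1 : u < 1) (m : ℕ) :
    (m : ℝ) * logErr u ≤ m * u / (1 - u) := by
  rw [mul_div_assoc]
  exact mul_le_mul_of_nonneg_left (logErr_le hu1) (Nat.cast_nonneg m)

/-- First-order reading, lower side: `Λ ≤ e^Λ − 1`. [cite: Higham2002ASNA, Lemma 3.1] -/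
theorem le_exp_sub_one (Λ : ℝ) : Λ ≤ Real.exp Λ - 1 := by
  linarith [Real.add_one_le_exp Λ]

/-- First-order reading, upper side: `e^Λ − 1 ≤ Λ/(1−Λ)` for `Λ < 1` (so a log-scale counter `Λ`
is a relative error `Λ + O(Λ²)`). [cite: Higham2002ASNA, Lemma 3.1] -/
theorem exp_sub_one_le_div {Λ : ℝ} (hΛ1 : Λ < 1) : Real.exp Λ - 1 ≤ Λ / (1 - Λ) := by
  have h1 : (0 : ℝ) < 1 - Λ := by linarith
  have h2 : 1 - Λ ≤ Real.exp (-Λ) := by linarith [Real.add_one_le_exp (-Λ)]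
  have h3 : Real.exp Λ * Real.exp (-Λ) = 1 := by
    rw [← Real.exp_add, add_neg_cancel, Real.exp_zero]
  have h4 : Real.exp Λ ≤ 1 / (1 - Λ) := by
    rw [le_div_iff₀ h1]
    calc Real.exp Λ * (1 - Λ) ≤ Real.exp Λ * Real.exp (-Λ) :=
          mul_le_mul_of_nonneg_left h2 (Real.exp_pos Λ).le
      _ = 1 := h3
  have h5 : 1 / (1 - Λ) - 1 = Λ / (1 - Λ) := by
    rw [div_sub_one h1.ne']
    congr 1
    ring
  linarith

/-- Log-scale accuracy: `LogAcc Λ a â :⇔ e^{−Λ}·a ≤ â ≤ e^{Λ}·a` ("`â = a(1+θ)` with the counter `Λ`").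
ENCODING (ours) of the `(1+θₖ)` factors. [cite: Higham2002ASNA, Lemma 3.1] -/
def LogAcc (Λ a â : ℝ) : Prop := Real.exp (-Λ) * a ≤ â ∧ â ≤ Real.exp Λ * a

namespace LogAcc

/-- Re-labelling the counter. [cite: Higham2002ASNA, Lemma 3.1] -/
theorem congr_left {Λ Λ' a â : ℝ} (h : LogAcc Λ a â) (e : Λ = Λ') : LogAcc Λ' a â := e ▸ h

/-- A log-accurate approximation of a nonnegative number is nonnegative.
[cite: Higham2002ASNA, Lemma 3.1] -/
theorem nonneg {Λ a â : ℝ} (h : LogAcc Λ a â) (ha : 0 ≤ a) : 0 ≤ â :=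
  le_trans (mul_nonneg (Real.exp_pos _).le ha) h.1

/-- A log-accurate approximation of a positive number is positive. [cite: Higham2002ASNA, Lemma 3.1] -/
theorem pos {Λ a â : ℝ} (h : LogAcc Λ a â) (ha : 0 < a) : 0 < â :=
  lt_of_lt_of_le (mul_pos (Real.exp_pos _) ha) h.1

/-- Exact data carry any nonnegative counter. [cite: Higham2002ASNA, Lemma 3.1] -/
theorem refl {Λ a : ℝ} (hΛ : 0 ≤ Λ) (ha : 0 ≤ a) : LogAcc Λ a a := by
  constructor
  · have h1 : Real.exp (-Λ) ≤ 1 := by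
      have := Real.exp_le_exp.mpr (show -Λ ≤ 0 by linarith)
      rwa [Real.exp_zero] at this
    exact mul_le_of_le_one_left ha h1
  · have h1 : 1 ≤ Real.exp Λ := by
      have := Real.exp_le_exp.mpr hΛ
      rwa [Real.exp_zero] at this
    exact le_mul_of_one_le_left ha h1

/-- Counters may be enlarged. [cite: Higham2002ASNA, Lemma 3.3] -/
theorem mono {Λ Λ' a â : ℝ} (h : LogAcc Λ a â) (hΛ : Λ ≤ Λ') (ha : 0 ≤ a) : LogAcc Λ' a â :=
  ⟨le_trans (mul_le_mul_of_nonneg_right (Real.exp_le_exp.mpr (neg_le_neg hΛ)) ha) h.1,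
    le_trans h.2 (mul_le_mul_of_nonneg_right (Real.exp_le_exp.mpr hΛ) ha)⟩

/-- Composition adds counters: `(1+θⱼ)(1+θₖ) = 1+θ_{j+k}`. [cite: Higham2002ASNA, Lemma 3.3] -/
theorem trans {Λ₁ Λ₂ a b c : ℝ} (h₁ : LogAcc Λ₁ a b) (h₂ : LogAcc Λ₂ b c) :
    LogAcc (Λ₁ + Λ₂) a c := by
  constructor
  · have h := mul_le_mul_of_nonneg_left h₁.1 (Real.exp_pos (-Λ₂)).le
    rw [neg_add, Real.exp_add]
    calc Real.exp (-Λ₁) * Real.exp (-Λ₂) * a = Real.exp (-Λ₂) * (Real.exp (-Λ₁) * a) := by ring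
      _ ≤ Real.exp (-Λ₂) * b := h
      _ ≤ c := h₂.1
  · have h := mul_le_mul_of_nonneg_left h₁.2 (Real.exp_pos Λ₂).le
    rw [Real.exp_add]
    calc c ≤ Real.exp Λ₂ * b := h₂.2
      _ ≤ Real.exp Λ₂ * (Real.exp Λ₁ * a) := h
      _ = Real.exp Λ₁ * Real.exp Λ₂ * a := by ring

/-- Exact addition keeps the larger counter (here: a common one). [cite: Higham2002ASNA, Lemma 3.3] -/
theorem add {Λ a â b b' : ℝ} (ha : LogAcc Λ a â) (hb : LogAcc Λ b b') :
    LogAcc Λ (a + b) (â + b') :=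
  ⟨by rw [mul_add]; exact add_le_add ha.1 hb.1, by rw [mul_add]; exact add_le_add ha.2 hb.2⟩

/-- Exact summation keeps a common counter. [cite: Higham2002ASNA, Lemma 3.3] -/
theorem sum {ι : Type*} {Λ : ℝ} (s : Finset ι) {a â : ι → ℝ}
    (h : ∀ i ∈ s, LogAcc Λ (a i) (â i)) : LogAcc Λ (∑ i ∈ s, a i) (∑ i ∈ s, â i) := by
  classical
  induction s using Finset.induction_on with
  | empty => simp [LogAcc]
  | insert j s hj ih =>
      rw [Finset.sum_insert hj, Finset.sum_insert hj]
      exact (h j (Finset.mem_insert_self j s)).add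
        (ih fun i hi => h i (Finset.mem_insert_of_mem hi))

/-- Exact products add counters (nonnegative data). [cite: Higham2002ASNA, Lemma 3.3] -/
theorem mul {Λ₁ Λ₂ a â b b' : ℝ} (ha : LogAcc Λ₁ a â) (hb : LogAcc Λ₂ b b') (ha0 : 0 ≤ a)
    (hb0 : 0 ≤ b) : LogAcc (Λ₁ + Λ₂) (a * b) (â * b') := by
  have hâ := ha.nonneg ha0
  have hb' := hb.nonneg hb0
  constructor
  · rw [neg_add, Real.exp_add]
    calc Real.exp (-Λ₁) * Real.exp (-Λ₂) * (a * b)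
          = (Real.exp (-Λ₁) * a) * (Real.exp (-Λ₂) * b) := by ring
      _ ≤ â * b' := mul_le_mul ha.1 hb.1 (mul_nonneg (Real.exp_pos _).le hb0) hâ
  · rw [Real.exp_add]
    calc â * b' ≤ (Real.exp Λ₁ * a) * (Real.exp Λ₂ * b) :=
          mul_le_mul ha.2 hb.2 hb' (mul_nonneg (Real.exp_pos _).le ha0)
      _ = Real.exp Λ₁ * Real.exp Λ₂ * (a * b) := by ring

/-- Exact reciprocals keep the counter (positive data). [cite: Higham2002ASNA, Lemma 3.3] -/
theorem inv {Λ a â : ℝ} (h : LogAcc Λ a â) (ha : 0 < a) : LogAcc Λ a⁻¹ â⁻¹ := by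
  have hâ := h.pos ha
  constructor
  · rw [show Real.exp (-Λ) * a⁻¹ = (Real.exp Λ * a)⁻¹ by rw [mul_inv, Real.exp_neg]]
    exact inv_anti₀ hâ h.2
  · rw [show Real.exp Λ * a⁻¹ = (Real.exp (-Λ) * a)⁻¹ by rw [mul_inv, Real.exp_neg, inv_inv]]
    exact inv_anti₀ (mul_pos (Real.exp_pos _) ha) h.1

/-- Exact quotients add counters. [cite: Higham2002ASNA, Lemma 3.3] -/
theorem div {Λ₁ Λ₂ a â b b' : ℝ} (ha : LogAcc Λ₁ a â) (hb : LogAcc Λ₂ b b') (ha0 : 0 ≤ a)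
    (hb0 : 0 < b) : LogAcc (Λ₁ + Λ₂) (a / b) (â / b') := by
  rw [div_eq_mul_inv, div_eq_mul_inv]
  exact ha.mul (hb.inv hb0) ha0 (inv_pos.mpr hb0).le

/-- ONE ROUNDING = ONE UNIT: `|δ| ≤ u < 1` gives `LogAcc (logErr u) 1 (1+δ)`
(`1 − u ≤ 1 + δ ≤ 1 + u ≤ 1/(1−u)`). [cite: BlanchardHighamHigham2021, §3 assumption (b)] -/
theorem one_add {u δ : ℝ} (hδ : |δ| ≤ u) (hu1 : u < 1) : LogAcc (logErr u) 1 (1 + δ) := by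
  have hd := abs_le.mp hδ
  have h1u : (0 : ℝ) < 1 - u := by linarith
  constructor
  · rw [exp_neg_logErr hu1, mul_one]; linarith
  · rw [exp_logErr hu1, mul_one, ← one_div, le_div_iff₀ h1u]
    nlinarith [mul_nonneg (sub_nonneg.mpr hd.2) h1u.le, sq_nonneg u]

/-- One more rounded operation on an approximation: `â(1+δ)` carries `Λ + logErr u`.
[cite: BlanchardHighamHigham2021, §3 assumption (b)] -/
theorem mul_one_add {Λ a â u δ : ℝ} (h : LogAcc Λ a â) (ha : 0 ≤ a) (hδ : |δ| ≤ u) (hu1 : u < 1) :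
    LogAcc (Λ + logErr u) a (â * (1 + δ)) := by
  have h' := h.mul (one_add hδ hu1) ha zero_le_one
  simpa only [mul_one] using h'

/-- Back to an absolute bound: `|â − a| ≤ (e^Λ − 1)·a` for `a ≥ 0` (the lower deviation
`(1 − e^{−Λ})a` is the smaller one since `e^Λ + e^{−Λ} ≥ 2`). [cite: Higham2002ASNA, Lemma 3.1] -/
theorem abs_sub_le {Λ a â : ℝ} (h : LogAcc Λ a â) (ha : 0 ≤ a) :
    |â - a| ≤ (Real.exp Λ - 1) * a := by
  have hcosh : 2 ≤ Real.exp Λ + Real.exp (-Λ) := by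
    have h1 := Real.add_one_le_exp Λ
    have h2 := Real.add_one_le_exp (-Λ)
    linarith
  have e1 : (Real.exp Λ - 1) * a = Real.exp Λ * a - a := by ring
  rw [abs_le, e1]
  constructor
  · have h3 : 0 ≤ (Real.exp Λ + Real.exp (-Λ) - 2) * a := mul_nonneg (by linarith) ha
    have e2 : (Real.exp Λ + Real.exp (-Λ) - 2) * a = Real.exp Λ * a + Real.exp (-Λ) * a - 2 * a := by
      ring
    linarith [h.1]
  · linarith [h.2]

/-- Back to a bound on logarithms: `|log â − log a| ≤ Λ` for `a > 0`.
[cite: BlanchardHighamHigham2021, §3 proof of Thm. 3.2] -/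
theorem abs_log_sub_log_le {Λ a â : ℝ} (h : LogAcc Λ a â) (ha : 0 < a) :
    |Real.log â - Real.log a| ≤ Λ := by
  have hâ := h.pos ha
  rw [abs_le]
  constructor
  · have h1 := Real.log_le_log (mul_pos (Real.exp_pos _) ha) h.1
    rw [Real.log_mul (Real.exp_pos _).ne' ha.ne', Real.log_exp] at h1
    linarith
  · have h1 := Real.log_le_log hâ h.2
    rw [Real.log_mul (Real.exp_pos _).ne' ha.ne', Real.log_exp] at h1
    linarith

end LogAcc

/-- A perturbed exponent: `|t' − t| ≤ R` gives `LogAcc R (e^t) (e^{t'})`.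
[cite: BlanchardHighamHigham2021, §4 eq. (4.5)] -/
theorem logAcc_exp_of_abs_sub_le {R t t' : ℝ} (h : |t' - t| ≤ R) :
    LogAcc R (Real.exp t) (Real.exp t') := by
  have h2 := abs_le.mp h
  constructor
  · rw [← Real.exp_add]; exact Real.exp_le_exp.mpr (by linarith)
  · rw [← Real.exp_add]; exact Real.exp_le_exp.mpr (by linarith)

/-! ### §0b The summation loop in the rounding-error model (ENCODING, ours) -/

/-- The loop `s = 0; for i = 1:m, s = fl(s + wᵢ)` with the first assignment exact:
`flSum w ε 0 = 0`, `flSum w ε 1 = w₀`, `flSum w ε (i+2) = (flSum w ε (i+1) + w_{i+1})(1 + ε_{i+1})`.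
[cite: BlanchardHighamHigham2021, Alg. 3.1 lines 1–5] -/
def flSum (w ε : ℕ → ℝ) : ℕ → ℝ
  | 0 => 0
  | 1 => w 0
  | i + 2 => (flSum w ε (i + 1) + w (i + 1)) * (1 + ε (i + 1))

/-- `flSum` is the tree's recursive summation shifted by one index: `flSum w ε (m+1) = recSum w ε m`.
[cite: Higham2002ASNA, §4.2 eq. (4.2)] -/
theorem flSum_succ_eq_recSum (w ε : ℕ → ℝ) : ∀ m : ℕ, flSum w ε (m + 1) = Higham2002.recSum w ε m
  | 0 => rfl
  | m + 1 => by
      show (flSum w ε (m + 1) + w (m + 1)) * (1 + ε (m + 1)) = _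
      rw [Higham2002.recSum, flSum_succ_eq_recSum w ε m]

/-- Without rounding errors the loop returns the exact sum. [cite: BlanchardHighamHigham2021, Alg. 3.1] -/
theorem flSum_exact (w : ℕ → ℝ) : ∀ m : ℕ, flSum w 0 m = ∑ i ∈ range m, w i
  | 0 => by simp [flSum]
  | 1 => by simp [flSum]
  | m + 2 => by
      show (flSum w 0 (m + 1) + w (m + 1)) * (1 + (0 : ℕ → ℝ) (m + 1))
        = ∑ i ∈ range (m + 1 + 1), w i
      rw [flSum_exact w (m + 1), Finset.sum_range_succ _ (m + 1)]
      simp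

/-- The absolute model bound of the loop, from the tree: `|flSum w ε (m+1) − Σ_{i≤m} wᵢ| ≤
((1+u)^m − 1)·Σ_{i≤m} |wᵢ|`. [cite: Higham2002ASNA, §4.2 eq. (4.3)] -/
theorem abs_flSum_sub_sum_le {u : ℝ} (hu : 0 ≤ u) (w ε : ℕ → ℝ) (hε : ∀ k, |ε k| ≤ u) (m : ℕ) :
    |flSum w ε (m + 1) - ∑ i ∈ range (m + 1), w i| ≤ ((1 + u) ^ m - 1) * ∑ i ∈ range (m + 1), |w i| := by
  rw [flSum_succ_eq_recSum]
  exact Higham2002.abs_recSum_sub_sum_le hu w ε hε m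

/-- NONNEGATIVE TERMS: `m + 1` terms summed with `m` rounded additions are log-accurate with `m`
units, `LogAcc (m·logErr u) (Σ_{i≤m} wᵢ) (flSum w ε (m+1))` — the "`|Δs| ≤ γ_{n−1} s`" step in the
proof of (3.3), exact. [cite: BlanchardHighamHigham2021, §3 eq. (3.3)] -/
theorem logAcc_flSum_succ {u : ℝ} (hu : 0 ≤ u) (hu1 : u < 1) (w ε : ℕ → ℝ) (hw : ∀ i, 0 ≤ w i)
    (hε : ∀ k, |ε k| ≤ u) :
    ∀ m : ℕ, LogAcc (m * logErr u) (∑ i ∈ range (m + 1), w i) (flSum w ε (m + 1))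
  | 0 => by
      rw [Nat.cast_zero, zero_mul, Finset.sum_range_one]
      exact LogAcc.refl le_rfl (hw 0)
  | m + 1 => by
      have ih := logAcc_flSum_succ hu hu1 w ε hw hε m
      have hterm : LogAcc (m * logErr u) (w (m + 1)) (w (m + 1)) :=
        LogAcc.refl (mul_nonneg (Nat.cast_nonneg m) (logErr_nonneg hu hu1)) (hw _)
      have h := (ih.add hterm).mul_one_add
        (add_nonneg (Finset.sum_nonneg fun i _ => hw i) (hw _)) (hε (m + 1)) hu1
      rw [Finset.sum_range_succ _ (m + 1)]
      show LogAcc _ _ ((flSum w ε (m + 1) + w (m + 1)) * (1 + ε (m + 1)))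
      exact h.congr_left (by push_cast; ring)

/-! ### §1 Log-sum-exp and softmax: definitions and exact facts -/

/-- `Σᵢ e^{xᵢ}` over `x₀,…,x_{n−1}`. ENCODING of the vector as `x : ℕ → ℝ` on `range n`.
[cite: BlanchardHighamHigham2021, eq. (1.1)] -/
def expSum (x : ℕ → ℝ) (n : ℕ) : ℝ := ∑ i ∈ range n, Real.exp (x i)

/-- Log-sum-exp `y = f(x) = log Σᵢ e^{xᵢ}`. [cite: BlanchardHighamHigham2021, eq. (1.1)] -/
def lse (x : ℕ → ℝ) (n : ℕ) : ℝ := Real.log (expSum x n)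

/-- Softmax `gⱼ(x) = e^{xⱼ} / Σᵢ e^{xᵢ}`. [cite: BlanchardHighamHigham2021, eq. (1.2)] -/
def softmax (x : ℕ → ℝ) (n j : ℕ) : ℝ := Real.exp (x j) / expSum x n

/-- `Σ e^{xᵢ} > 0` (`n ≥ 1`). [cite: BlanchardHighamHigham2021, eq. (1.1)] -/
theorem expSum_pos (x : ℕ → ℝ) {n : ℕ} (hn : 0 < n) : 0 < expSum x n := by
  unfold expSum
  exact Finset.sum_pos (fun i _ => Real.exp_pos _) (Finset.nonempty_range_iff.mpr hn.ne')

/-- Each term is below the sum. [cite: BlanchardHighamHigham2021, eq. (4.2)] -/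
theorem exp_le_expSum (x : ℕ → ℝ) {n j : ℕ} (hj : j < n) : Real.exp (x j) ≤ expSum x n := by
  unfold expSum
  exact Finset.single_le_sum (f := fun i => Real.exp (x i)) (fun i _ => (Real.exp_pos _).le)
    (Finset.mem_range.mpr hj)

/-- `Σ e^{xᵢ} ≤ n·e^{a}` when all `xᵢ ≤ a`. [cite: BlanchardHighamHigham2021, eq. (4.2)] -/
theorem expSum_le (x : ℕ → ℝ) {n : ℕ} {a : ℝ} (ha : ∀ i < n, x i ≤ a) :
    expSum x n ≤ n * Real.exp a := by
  unfold expSum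
  calc ∑ i ∈ range n, Real.exp (x i) ≤ ∑ _i ∈ range n, Real.exp a :=
        Finset.sum_le_sum fun i hi => Real.exp_le_exp.mpr (ha i (Finset.mem_range.mp hi))
    _ = n * Real.exp a := by rw [Finset.sum_const, Finset.card_range, nsmul_eq_mul]

/-- (4.2), lower half: `xⱼ ≤ y`, in particular `x_max ≤ y`. [cite: BlanchardHighamHigham2021, eq. (4.2)] -/
theorem le_lse (x : ℕ → ℝ) {n j : ℕ} (hj : j < n) : x j ≤ lse x n := by
  have h := Real.log_le_log (Real.exp_pos (x j)) (exp_le_expSum x hj)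
  rwa [Real.log_exp] at h

/-- (4.2), upper half: `y ≤ x_max + log n` (any upper bound `a` of the `xᵢ`).
[cite: BlanchardHighamHigham2021, eq. (4.2)] -/
theorem lse_le (x : ℕ → ℝ) {n : ℕ} (hn : 0 < n) {a : ℝ} (ha : ∀ i < n, x i ≤ a) :
    lse x n ≤ a + Real.log n := by
  have hn' : (0 : ℝ) < n := Nat.cast_pos.mpr hn
  have h := Real.log_le_log (expSum_pos x hn) (expSum_le x ha)
  rw [Real.log_mul hn'.ne' (Real.exp_pos a).ne', Real.log_exp] at h
  unfold lse; linarith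

/-- (4.3): `|y − xⱼ| ≤ |x_max − xⱼ| + log n`. [cite: BlanchardHighamHigham2021, eq. (4.3)] -/
theorem abs_lse_sub_le (x : ℕ → ℝ) {n j : ℕ} (hj : j < n) {a : ℝ} (ha : ∀ i < n, x i ≤ a) :
    |lse x n - x j| ≤ |a - x j| + Real.log n := by
  have h1 := le_lse x hj
  have h2 := lse_le x (lt_of_le_of_lt (Nat.zero_le j) hj) ha
  rw [abs_of_nonneg (show 0 ≤ lse x n - x j by linarith)]
  have h3 := le_abs_self (a - x j)
  linarith

/-- `gⱼ > 0`. [cite: BlanchardHighamHigham2021, eq. (1.2)] -/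
theorem softmax_pos (x : ℕ → ℝ) {n : ℕ} (hn : 0 < n) (j : ℕ) : 0 < softmax x n j := by
  unfold softmax
  exact div_pos (Real.exp_pos _) (expSum_pos x hn)

/-- `gⱼ ≤ 1`. [cite: BlanchardHighamHigham2021, eq. (1.2)] -/
theorem softmax_le_one (x : ℕ → ℝ) {n j : ℕ} (hj : j < n) : softmax x n j ≤ 1 := by
  unfold softmax
  exact (div_le_one (expSum_pos x (lt_of_le_of_lt (Nat.zero_le j) hj))).mpr (exp_le_expSum x hj)

/-- `Σⱼ gⱼ = 1`. [cite: BlanchardHighamHigham2021, eq. (1.2)] -/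
theorem sum_softmax (x : ℕ → ℝ) {n : ℕ} (hn : 0 < n) : ∑ j ∈ range n, softmax x n j = 1 := by
  unfold softmax
  rw [← Finset.sum_div]
  exact div_self (expSum_pos x hn).ne'

/-- `‖g‖_∞ ≥ 1/n`: the maximal component is at least `1/n` (used in the proof of Theorem 3.3).
[cite: BlanchardHighamHigham2021, §3 proof of Thm. 3.3] -/
theorem inv_le_softmax_max (x : ℕ → ℝ) {n k : ℕ} (hk : k < n) (hmax : ∀ i < n, x i ≤ x k) :
    (n : ℝ)⁻¹ ≤ softmax x n k := by
  have hn : 0 < n := lt_of_le_of_lt (Nat.zero_le k) hk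
  have hn' : (0 : ℝ) < n := Nat.cast_pos.mpr hn
  unfold softmax
  rw [inv_eq_one_div, div_le_div_iff₀ hn' (expSum_pos x hn), one_mul, mul_comm]
  exact expSum_le x hmax

/-- Shifting the data: `Σ e^{xᵢ − a} = e^{−a} Σ e^{xᵢ}`. [cite: BlanchardHighamHigham2021, eq. (1.3)] -/
theorem expSum_shift (x : ℕ → ℝ) (a : ℝ) (n : ℕ) :
    expSum (fun i => x i - a) n = Real.exp (-a) * expSum x n := by
  unfold expSum
  rw [Finset.mul_sum]
  refine Finset.sum_congr rfl fun i _ => ?_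
  show Real.exp (x i - a) = Real.exp (-a) * Real.exp (x i)
  rw [sub_eq_add_neg, Real.exp_add, mul_comm]

/-- (1.3): `y = a + log Σ e^{xᵢ − a}` for any shift `a`. [cite: BlanchardHighamHigham2021, eq. (1.3)] -/
theorem lse_shift (x : ℕ → ℝ) (a : ℝ) {n : ℕ} (hn : 0 < n) :
    lse x n = a + lse (fun i => x i - a) n := by
  unfold lse
  rw [expSum_shift, Real.log_mul (Real.exp_pos _).ne' (expSum_pos x hn).ne', Real.log_exp]
  ring

/-- (1.4): softmax is shift invariant. [cite: BlanchardHighamHigham2021, eq. (1.4)] -/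
theorem softmax_shift (x : ℕ → ℝ) (a : ℝ) (n j : ℕ) :
    softmax (fun i => x i - a) n j = softmax x n j := by
  show Real.exp (x j - a) / expSum (fun i => x i - a) n = Real.exp (x j) / expSum x n
  rw [expSum_shift, sub_eq_add_neg, Real.exp_add, mul_comm (Real.exp (x j)),
    mul_div_mul_left _ _ (Real.exp_pos (-a)).ne']

/-- (1.5): the division-free formula `gⱼ = exp(xⱼ − log Σ e^{xᵢ})`.
[cite: BlanchardHighamHigham2021, eq. (1.5)] -/
theorem softmax_eq_exp_sub_lse (x : ℕ → ℝ) {n : ℕ} (hn : 0 < n) (j : ℕ) :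
    softmax x n j = Real.exp (x j - lse x n) := by
  unfold softmax lse
  rw [Real.exp_sub, Real.exp_log (expSum_pos x hn)]

/-- Updating one coordinate: `Σᵢ e^{(x[j ↦ t])ᵢ} = e^t + Σ_{i ≠ j} e^{xᵢ}`.
[cite: BlanchardHighamHigham2021, eq. (1.2)] -/
theorem expSum_update (x : ℕ → ℝ) {n j : ℕ} (hj : j < n) (t : ℝ) :
    expSum (Function.update x j t) n = Real.exp t + ∑ i ∈ (range n).erase j, Real.exp (x i) := by
  unfold expSum
  rw [← Finset.add_sum_erase _ _ (Finset.mem_range.mpr hj), Function.update_self]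
  congr 1
  refine Finset.sum_congr rfl fun i hi => ?_
  rw [Function.update_of_ne (Finset.ne_of_mem_erase hi)]

/-- (1.2): SOFTMAX IS THE GRADIENT OF LOG-SUM-EXP, `∂f/∂xⱼ (x) = gⱼ(x)`.
[cite: BlanchardHighamHigham2021, eq. (1.2)] -/
theorem hasDerivAt_lse (x : ℕ → ℝ) {n j : ℕ} (hj : j < n) :
    HasDerivAt (fun t => lse (Function.update x j t) n) (softmax x n j) (x j) := by
  have hfun : (fun t => lse (Function.update x j t) n) =
      fun t => Real.log (Real.exp t + ∑ i ∈ (range n).erase j, Real.exp (x i)) := by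
    funext t
    rw [lse, expSum_update x hj]
  have hval : expSum x n = Real.exp (x j) + ∑ i ∈ (range n).erase j, Real.exp (x i) := by
    have h := expSum_update x hj (x j)
    rwa [Function.update_eq_self] at h
  have hpos : Real.exp (x j) + ∑ i ∈ (range n).erase j, Real.exp (x i) ≠ 0 := by
    have : 0 ≤ ∑ i ∈ (range n).erase j, Real.exp (x i) :=
      Finset.sum_nonneg fun i _ => (Real.exp_pos _).le
    have : 0 < Real.exp (x j) + ∑ i ∈ (range n).erase j, Real.exp (x i) := by
      have := Real.exp_pos (x j); linarith
    exact this.ne'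
  rw [hfun, softmax, hval]
  exact ((Real.hasDerivAt_exp (x j)).add_const _).log hpos

/-- The softmax Jacobian of §2, `G = (∂gᵢ/∂xⱼ) = diag(g) − g gᵀ`: `Gᵢᵢ = gᵢ − gᵢ²`, `Gᵢⱼ = −gᵢgⱼ`
(`i ≠ j`), entered by its printed closed form. [cite: BlanchardHighamHigham2021, §2 (softmax Jacobian)] -/
def softmaxJac (x : ℕ → ℝ) (n i j : ℕ) : ℝ :=
  if i = j then softmax x n i - softmax x n i ^ 2 else -(softmax x n i * softmax x n j)

/-- Row sums of `|G|`: `Σⱼ |Gᵢⱼ| = 2gᵢ(1 − gᵢ)`. [cite: BlanchardHighamHigham2021, §2 (‖G‖∞ ≤ 1)] -/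
theorem sum_abs_softmaxJac (x : ℕ → ℝ) {n i : ℕ} (hi : i < n) :
    ∑ j ∈ range n, |softmaxJac x n i j| = 2 * softmax x n i * (1 - softmax x n i) := by
  have hn : 0 < n := lt_of_le_of_lt (Nat.zero_le i) hi
  have hgi0 := (softmax_pos x hn i).le
  have hgi1 := softmax_le_one x hi
  rw [← Finset.add_sum_erase _ _ (Finset.mem_range.mpr hi)]
  have hdiag : |softmaxJac x n i i| = softmax x n i * (1 - softmax x n i) := by
    rw [softmaxJac, if_pos rfl, abs_of_nonneg (by nlinarith)]
    ring
  have hoff : ∀ j ∈ (range n).erase i, |softmaxJac x n i j| = softmax x n i * softmax x n j := by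
    intro j hj
    rw [softmaxJac, if_neg (Finset.ne_of_mem_erase hj).symm, abs_neg,
      abs_of_nonneg (mul_nonneg hgi0 (softmax_pos x hn j).le)]
  rw [hdiag, Finset.sum_congr rfl hoff, ← Finset.mul_sum]
  have hrest : ∑ j ∈ (range n).erase i, softmax x n j = 1 - softmax x n i := by
    have h := Finset.add_sum_erase (range n) (softmax x n) (Finset.mem_range.mpr hi)
    rw [sum_softmax x hn] at h
    linarith
  rw [hrest]
  ring

/-- `‖G‖_∞ ≤ 1`: every row sum of `|G|` is at most `1` (indeed `≤ 1/2`).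
[cite: BlanchardHighamHigham2021, §2 (‖G‖∞ ≤ 1)] -/
theorem sum_abs_softmaxJac_le_one (x : ℕ → ℝ) {n i : ℕ} (hi : i < n) :
    ∑ j ∈ range n, |softmaxJac x n i j| ≤ 1 := by
  rw [sum_abs_softmaxJac x hi]
  have hgi0 := (softmax_pos x (lt_of_le_of_lt (Nat.zero_le i) hi) i).le
  have hgi1 := softmax_le_one x hi
  nlinarith [sq_nonneg (2 * softmax x n i - 1)]

/-! ### §2 Algorithm 3.1 (unshifted) in the rounding-error model and THEOREMS 3.2, 3.3, 3.4 -/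

/-- (3.1): the computed exponentials `ŵᵢ = e^{xᵢ}(1 + δᵢ)`. [cite: BlanchardHighamHigham2021, eq. (3.1)] -/
def wHat (x δ : ℕ → ℝ) (i : ℕ) : ℝ := Real.exp (x i) * (1 + δ i)

/-- The computed sum `ŝ` of Algorithm 3.1 (loop of lines 1–5). [cite: BlanchardHighamHigham2021, Alg. 3.1] -/
def sHat (x δ ε : ℕ → ℝ) (n : ℕ) : ℝ := flSum (wHat x δ) ε n

/-- The computed log-sum-exp `ŷ = fl(log ŝ) = log(ŝ)(1 + τ)` (Algorithm 3.1 line 6).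
[cite: BlanchardHighamHigham2021, Alg. 3.1] -/
def lseHat (x δ ε : ℕ → ℝ) (τ : ℝ) (n : ℕ) : ℝ := Real.log (sHat x δ ε n) * (1 + τ)

/-- The computed softmax `ĝⱼ = fl(ŵⱼ/ŝ) = (ŵⱼ/ŝ)(1 + ζⱼ)` (Algorithm 3.1 lines 7–9).
[cite: BlanchardHighamHigham2021, Alg. 3.1] -/
def softmaxHat (x δ ε ζ : ℕ → ℝ) (n j : ℕ) : ℝ := wHat x δ j / sHat x δ ε n * (1 + ζ j)

/-- The division-free softmax (3.7)/(1.5) computed from an approximation `ŷ`: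
`ĝⱼ = fl(exp(fl(xⱼ − ŷ))) = exp((xⱼ − ŷ)(1 + κⱼ))(1 + νⱼ)`. [cite: BlanchardHighamHigham2021, eq. (3.7)] -/
def softmaxAltHat (x κ ν : ℕ → ℝ) (yh : ℝ) (j : ℕ) : ℝ :=
  Real.exp ((x j - yh) * (1 + κ j)) * (1 + ν j)

/-- With no rounding errors the model returns the exact sum. [cite: BlanchardHighamHigham2021, Alg. 3.1] -/
theorem sHat_exact (x : ℕ → ℝ) (n : ℕ) : sHat x 0 0 n = expSum x n := by
  unfold sHat expSum
  rw [flSum_exact]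
  refine Finset.sum_congr rfl fun i _ => ?_
  simp [wHat]

/-- `ŵᵢ ≥ 0`. [cite: BlanchardHighamHigham2021, eq. (3.1)] -/
theorem wHat_nonneg {u : ℝ} (hu1 : u < 1) (x δ : ℕ → ℝ) (hδ : ∀ i, |δ i| ≤ u) (i : ℕ) :
    0 ≤ wHat x δ i :=
  mul_nonneg (Real.exp_pos _).le (by have := (abs_le.mp (hδ i)).1; linarith)

/-- (3.1) on the log scale: `ŵᵢ` carries one unit. [cite: BlanchardHighamHigham2021, eq. (3.1)] -/
theorem logAcc_wHat {u : ℝ} (hu1 : u < 1) (x δ : ℕ → ℝ) (hδ : ∀ i, |δ i| ≤ u) (i : ℕ) :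
    LogAcc (logErr u) (Real.exp (x i)) (wHat x δ i) := by
  have h := (LogAcc.refl le_rfl (Real.exp_pos (x i)).le).mul_one_add (Real.exp_pos (x i)).le
    (hδ i) hu1
  rw [zero_add] at h
  exact h

/-- (3.3) exact: the computed sum carries `n` units, `e^{−nℓ}s ≤ ŝ ≤ e^{nℓ}s` (`n ≥ 1` terms: one unit
from the exponentials, `n − 1` from the additions). [cite: BlanchardHighamHigham2021, eq. (3.3)] -/
theorem logAcc_sHat {u : ℝ} (hu : 0 ≤ u) (hu1 : u < 1) (x δ ε : ℕ → ℝ) (hδ : ∀ i, |δ i| ≤ u)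
    (hε : ∀ k, |ε k| ≤ u) {n : ℕ} (hn : 0 < n) :
    LogAcc (n * logErr u) (expSum x n) (sHat x δ ε n) := by
  obtain ⟨m, rfl⟩ : ∃ m, n = m + 1 := ⟨n - 1, by omega⟩
  have h1 : LogAcc (logErr u) (expSum x (m + 1)) (∑ i ∈ range (m + 1), wHat x δ i) :=
    LogAcc.sum _ fun i _ => logAcc_wHat hu1 x δ hδ i
  have h2 := logAcc_flSum_succ hu hu1 (wHat x δ) ε (wHat_nonneg hu1 x δ hδ) hε m
  exact (h1.trans h2).congr_left (by push_cast; ring)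

/-- (3.3) as an absolute bound: `|ŝ − s| ≤ ((1−u)^{−n} − 1)·s`.
[cite: BlanchardHighamHigham2021, eq. (3.3)] -/
theorem abs_sHat_sub_le {u : ℝ} (hu : 0 ≤ u) (hu1 : u < 1) (x δ ε : ℕ → ℝ) (hδ : ∀ i, |δ i| ≤ u)
    (hε : ∀ k, |ε k| ≤ u) {n : ℕ} (hn : 0 < n) :
    |sHat x δ ε n - expSum x n| ≤ (((1 - u) ^ n)⁻¹ - 1) * expSum x n := by
  have h := (logAcc_sHat hu hu1 x δ ε hδ hε hn).abs_sub_le (expSum_pos x hn).le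
  rwa [exp_natMul_logErr hu1] at h

/-- (3.3) in `γ` form: `|ŝ − s| ≤ γₙ·s` (`nu < 1`); printed: `(n+1)u·s + O(u²)`.
[cite: BlanchardHighamHigham2021, eq. (3.3)] -/
theorem abs_sHat_sub_le_gamma {u : ℝ} (hu : 0 ≤ u) (hu1 : u < 1) (x δ ε : ℕ → ℝ)
    (hδ : ∀ i, |δ i| ≤ u) (hε : ∀ k, |ε k| ≤ u) {n : ℕ} (hn : 0 < n) (hnu : (n : ℝ) * u < 1) :
    |sHat x δ ε n - expSum x n| ≤ Higham2002.gamma u n * expSum x n :=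
  le_trans (abs_sHat_sub_le hu hu1 x δ ε hδ hε hn)
    (mul_le_mul_of_nonneg_right (Higham2002.inv_one_sub_pow_sub_one_le_gamma hu1 hnu)
      (expSum_pos x hn).le)

/-- **THEOREM 3.2** (log-sum-exp, Algorithm 3.1), exact form: `|y − ŷ| ≤ u|y| + (1+u)·n·logErr u`
(the source's `ŷ = (y + log(1+η))(1+ε)`, `|log(1+η)| ≤ nℓ`, `|ε| ≤ u`, without dropping the
second-order terms). [cite: BlanchardHighamHigham2021, Thm. 3.2] -/
theorem abs_lse_sub_lseHat_le {u : ℝ} (hu : 0 ≤ u) (hu1 : u < 1) (x δ ε : ℕ → ℝ) {τ : ℝ}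
    (hδ : ∀ i, |δ i| ≤ u) (hε : ∀ k, |ε k| ≤ u) (hτ : |τ| ≤ u) {n : ℕ} (hn : 0 < n) :
    |lse x n - lseHat x δ ε τ n| ≤ u * |lse x n| + (1 + u) * (n * logErr u) := by
  have hs := expSum_pos x hn
  have hΔ := (logAcc_sHat hu hu1 x δ ε hδ hε hn).abs_log_sub_log_le hs
  have key : lse x n - lseHat x δ ε τ n =
      -(Real.log (sHat x δ ε n) - Real.log (expSum x n))
        - τ * (lse x n + (Real.log (sHat x δ ε n) - Real.log (expSum x n))) := by
    unfold lseHat lse; ring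
  rw [key]
  generalize Real.log (sHat x δ ε n) - Real.log (expSum x n) = Δ at hΔ ⊢
  generalize lse x n = y
  have h1 : |-Δ - τ * (y + Δ)| ≤ |Δ| + |τ| * (|y| + |Δ|) := by
    calc |-Δ - τ * (y + Δ)| ≤ |-Δ| + |τ * (y + Δ)| := abs_sub _ _
      _ = |Δ| + |τ| * |y + Δ| := by rw [abs_neg, abs_mul]
      _ ≤ |Δ| + |τ| * (|y| + |Δ|) := by
          have := mul_le_mul_of_nonneg_left (abs_add_le y Δ) (abs_nonneg τ)
          linarith
  have h2 : |τ| * (|y| + |Δ|) ≤ u * |y| + u * |Δ| := by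
    rw [← mul_add]
    exact mul_le_mul_of_nonneg_right hτ (add_nonneg (abs_nonneg _) (abs_nonneg _))
  have h3 : u * |Δ| ≤ u * (n * logErr u) := mul_le_mul_of_nonneg_left hΔ hu
  have h4 : (1 + u) * (n * logErr u) = n * logErr u + u * (n * logErr u) := by ring
  linarith

/-- **THEOREM 3.2** in Higham's `γ`-free first-order shape: `|y − ŷ| ≤ u|y| + (1+u)·nu/(1−u)`.
[cite: BlanchardHighamHigham2021, Thm. 3.2] -/
theorem abs_lse_sub_lseHat_le' {u : ℝ} (hu : 0 ≤ u) (hu1 : u < 1) (x δ ε : ℕ → ℝ) {τ : ℝ}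
    (hδ : ∀ i, |δ i| ≤ u) (hε : ∀ k, |ε k| ≤ u) (hτ : |τ| ≤ u) {n : ℕ} (hn : 0 < n) :
    |lse x n - lseHat x δ ε τ n| ≤ u * |lse x n| + (1 + u) * (n * u / (1 - u)) := by
  have h := abs_lse_sub_lseHat_le hu hu1 x δ ε hδ hε hτ hn
  have h2 := mul_le_mul_of_nonneg_left (natMul_logErr_le hu1 n) (show (0 : ℝ) ≤ 1 + u by linarith)
  linarith

/-- **THEOREM 3.2**, relative form (3.5) for `y ≠ 0`: `|y − ŷ|/|y| ≤ u + (1+u)·n·logErr u/|y|`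
`= (1 + n/|y|)u + O(u²)`. [cite: BlanchardHighamHigham2021, Thm. 3.2 eq. (3.5)] -/
theorem abs_lse_sub_lseHat_div_le {u : ℝ} (hu : 0 ≤ u) (hu1 : u < 1) (x δ ε : ℕ → ℝ) {τ : ℝ}
    (hδ : ∀ i, |δ i| ≤ u) (hε : ∀ k, |ε k| ≤ u) (hτ : |τ| ≤ u) {n : ℕ} (hn : 0 < n)
    (hy : lse x n ≠ 0) :
    |lse x n - lseHat x δ ε τ n| / |lse x n| ≤ u + (1 + u) * (n * logErr u) / |lse x n| := by
  have hypos : 0 < |lse x n| := abs_pos.mpr hy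
  rw [div_le_iff₀ hypos, add_mul, div_mul_cancel₀ _ hypos.ne']
  exact abs_lse_sub_lseHat_le hu hu1 x δ ε hδ hε hτ hn

/-- **THEOREM 3.3** (softmax, Algorithm 3.1), exact form on the log scale: `ĝⱼ` carries `n + 2` units
(`1` exponential, `n` for `ŝ`, `1` division). [cite: BlanchardHighamHigham2021, Thm. 3.3] -/
theorem logAcc_softmaxHat {u : ℝ} (hu : 0 ≤ u) (hu1 : u < 1) (x δ ε ζ : ℕ → ℝ)
    (hδ : ∀ i, |δ i| ≤ u) (hε : ∀ k, |ε k| ≤ u) (hζ : ∀ j, |ζ j| ≤ u) {n : ℕ} (hn : 0 < n) (j : ℕ) :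
    LogAcc ((n + 2) * logErr u) (softmax x n j) (softmaxHat x δ ε ζ n j) := by
  have h1 := logAcc_wHat hu1 x δ hδ j
  have h2 := logAcc_sHat hu hu1 x δ ε hδ hε hn
  have h3 := (h1.div h2 (Real.exp_pos _).le (expSum_pos x hn)).mul_one_add
    (div_nonneg (Real.exp_pos _).le (expSum_pos x hn).le) (hζ j) hu1
  exact h3.congr_left (by ring)

/-- **THEOREM 3.3** as an absolute bound: `|ĝⱼ − gⱼ| ≤ ((1−u)^{−(n+2)} − 1)·gⱼ`.
[cite: BlanchardHighamHigham2021, Thm. 3.3] -/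
theorem abs_softmaxHat_sub_le {u : ℝ} (hu : 0 ≤ u) (hu1 : u < 1) (x δ ε ζ : ℕ → ℝ)
    (hδ : ∀ i, |δ i| ≤ u) (hε : ∀ k, |ε k| ≤ u) (hζ : ∀ j, |ζ j| ≤ u) {n : ℕ} (hn : 0 < n) (j : ℕ) :
    |softmaxHat x δ ε ζ n j - softmax x n j| ≤ (((1 - u) ^ (n + 2))⁻¹ - 1) * softmax x n j := by
  have h := (logAcc_softmaxHat hu hu1 x δ ε ζ hδ hε hζ hn j).abs_sub_le (softmax_pos x hn j).le
  rw [show ((n : ℝ) + 2) = ((n + 2 : ℕ) : ℝ) by push_cast; ring, exp_natMul_logErr hu1] at h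
  exact h

/-- **THEOREM 3.3** in `γ` form: `|ĝⱼ − gⱼ| ≤ γ_{n+2}·gⱼ` (`(n+2)u < 1`) = `(n+2)u·gⱼ + O(u²)`; printed
(3.6): `(n+3)u + O(u²)`. [cite: BlanchardHighamHigham2021, Thm. 3.3 eq. (3.6)] -/
theorem abs_softmaxHat_sub_le_gamma {u : ℝ} (hu : 0 ≤ u) (hu1 : u < 1) (x δ ε ζ : ℕ → ℝ)
    (hδ : ∀ i, |δ i| ≤ u) (hε : ∀ k, |ε k| ≤ u) (hζ : ∀ j, |ζ j| ≤ u) {n : ℕ} (hn : 0 < n)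
    (hnu : ((n + 2 : ℕ) : ℝ) * u < 1) (j : ℕ) :
    |softmaxHat x δ ε ζ n j - softmax x n j| ≤ Higham2002.gamma u (n + 2) * softmax x n j :=
  le_trans (abs_softmaxHat_sub_le hu hu1 x δ ε ζ hδ hε hζ hn j)
    (mul_le_mul_of_nonneg_right (Higham2002.inv_one_sub_pow_sub_one_le_gamma hu1 hnu)
      (softmax_pos x hn j).le)

/-- **THEOREM 3.3**, normwise (3.6): `‖ĝ − g‖_∞ ≤ γ_{n+2}‖g‖_∞` (any common bound `M` of the `gᵢ`).
[cite: BlanchardHighamHigham2021, Thm. 3.3 eq. (3.6)] -/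
theorem abs_softmaxHat_sub_le_gamma_norm {u : ℝ} (hu : 0 ≤ u) (hu1 : u < 1) (x δ ε ζ : ℕ → ℝ)
    (hδ : ∀ i, |δ i| ≤ u) (hε : ∀ k, |ε k| ≤ u) (hζ : ∀ j, |ζ j| ≤ u) {n : ℕ} (hn : 0 < n)
    (hnu : ((n + 2 : ℕ) : ℝ) * u < 1) {M : ℝ} (hM : ∀ i < n, softmax x n i ≤ M) {j : ℕ} (hj : j < n) :
    |softmaxHat x δ ε ζ n j - softmax x n j| ≤ Higham2002.gamma u (n + 2) * M :=
  le_trans (abs_softmaxHat_sub_le_gamma hu hu1 x δ ε ζ hδ hε hζ hn hnu j)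
    (mul_le_mul_of_nonneg_left (hM j hj) (Higham2002.gamma_nonneg hu hnu))

/-- **THEOREM 3.4** (division-free softmax (3.7)), exact and for ANY approximation `ŷ` of `y`:
`ĝⱼ = exp((xⱼ − ŷ)(1+κⱼ))(1+νⱼ)` carries `|xⱼ − y|u + (1+u)|y − ŷ| + logErr u` on the log scale
(the source's expansion (3.8)–(3.10), kept exact). [cite: BlanchardHighamHigham2021, Thm. 3.4] -/
theorem logAcc_softmaxAltHat {u : ℝ} (hu1 : u < 1) (x κ ν : ℕ → ℝ) {n j : ℕ} (hn : 0 < n)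
    (hκ : |κ j| ≤ u) (hν : |ν j| ≤ u) (yh : ℝ) :
    LogAcc (|x j - lse x n| * u + (1 + u) * |lse x n - yh| + logErr u)
      (softmax x n j) (softmaxAltHat x κ ν yh j) := by
  rw [softmax_eq_exp_sub_lse x hn j]
  have h1k : |1 + κ j| ≤ 1 + u := le_trans (abs_add_le _ _) (by rw [abs_one]; linarith)
  have hR : |(x j - yh) * (1 + κ j) - (x j - lse x n)|
      ≤ |x j - lse x n| * u + (1 + u) * |lse x n - yh| := by
    have e : (x j - yh) * (1 + κ j) - (x j - lse x n)
        = (x j - lse x n) * κ j + (1 + κ j) * (lse x n - yh) := by ring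
    rw [e]
    calc |(x j - lse x n) * κ j + (1 + κ j) * (lse x n - yh)|
          ≤ |(x j - lse x n) * κ j| + |(1 + κ j) * (lse x n - yh)| := abs_add_le _ _
      _ = |x j - lse x n| * |κ j| + |1 + κ j| * |lse x n - yh| := by rw [abs_mul, abs_mul]
      _ ≤ |x j - lse x n| * u + (1 + u) * |lse x n - yh| :=
          add_le_add (mul_le_mul_of_nonneg_left hκ (abs_nonneg _))
            (mul_le_mul_of_nonneg_right h1k (abs_nonneg _))
  exact (logAcc_exp_of_abs_sub_le hR).mul_one_add (Real.exp_pos _).le hν hu1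

/-- **THEOREM 3.4** for Algorithm 3.1's `ŷ`: counter `|xⱼ − y|u + (1+u)(u|y| + (1+u)n·logErr u) +
logErr u = (1 + |xⱼ − y| + |y| + n)u + O(u²)`; printed (3.11): `(|y| + max|xⱼ − y| + n + 2)u`.
[cite: BlanchardHighamHigham2021, Thm. 3.4 eq. (3.11)] -/
theorem logAcc_softmaxAltHat_basic {u : ℝ} (hu : 0 ≤ u) (hu1 : u < 1) (x δ ε κ ν : ℕ → ℝ)
    {τ : ℝ} (hδ : ∀ i, |δ i| ≤ u) (hε : ∀ k, |ε k| ≤ u) (hτ : |τ| ≤ u) {n j : ℕ} (hn : 0 < n)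
    (hκ : |κ j| ≤ u) (hν : |ν j| ≤ u) :
    LogAcc (|x j - lse x n| * u + (1 + u) * (u * |lse x n| + (1 + u) * (n * logErr u)) + logErr u)
      (softmax x n j) (softmaxAltHat x κ ν (lseHat x δ ε τ n) j) := by
  have h := logAcc_softmaxAltHat hu1 x κ ν hn hκ hν (lseHat x δ ε τ n)
  refine h.mono ?_ (softmax_pos x hn j).le
  have hb := abs_lse_sub_lseHat_le hu hu1 x δ ε hδ hε hτ hn
  have h2 := mul_le_mul_of_nonneg_left hb (show (0 : ℝ) ≤ 1 + u by linarith)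
  linarith

/-- **THEOREM 3.4** as an absolute bound: `|ĝⱼ − gⱼ| ≤ (e^{Λⱼ} − 1)gⱼ` with the counter `Λⱼ` of
`logAcc_softmaxAltHat_basic`. [cite: BlanchardHighamHigham2021, Thm. 3.4 eq. (3.11)] -/
theorem abs_softmaxAltHat_sub_le_basic {u : ℝ} (hu : 0 ≤ u) (hu1 : u < 1) (x δ ε κ ν : ℕ → ℝ)
    {τ : ℝ} (hδ : ∀ i, |δ i| ≤ u) (hε : ∀ k, |ε k| ≤ u) (hτ : |τ| ≤ u) {n j : ℕ} (hn : 0 < n)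
    (hκ : |κ j| ≤ u) (hν : |ν j| ≤ u) :
    |softmaxAltHat x κ ν (lseHat x δ ε τ n) j - softmax x n j|
      ≤ (Real.exp (|x j - lse x n| * u + (1 + u) * (u * |lse x n| + (1 + u) * (n * logErr u))
          + logErr u) - 1) * softmax x n j :=
  (logAcc_softmaxAltHat_basic hu hu1 x δ ε κ ν hδ hε hτ hn hκ hν).abs_sub_le (softmax_pos x hn j).le

/-! ### §3 Algorithm 4.1 (shift by the maximum) and THEOREMS 4.2, 4.3, 4.4

Data `x₀, …, x_N` (`n = N + 1` entries) with the maximal one LAST, `a = x_N`; the loop of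
Algorithm 4.1 runs over the `N` indices `i < N` (`i ≠ k`). -/

/-- (4.4): `s = Σ_{i ≠ k} e^{xᵢ − a}` with `k = N` last, `a = x_N`. [cite: BlanchardHighamHigham2021, eq. (4.4)] -/
def shiftSum (x : ℕ → ℝ) (N : ℕ) : ℝ := ∑ i ∈ range N, Real.exp (x i - x N)

/-- Algorithm 4.1 line 4 in the model: `ŵᵢ = fl(exp(fl(xᵢ − a))) = exp((xᵢ − a)(1+σᵢ))(1+δᵢ)`.
[cite: BlanchardHighamHigham2021, Alg. 4.1] -/
def wHatS (x σ δ : ℕ → ℝ) (N i : ℕ) : ℝ := Real.exp ((x i - x N) * (1 + σ i)) * (1 + δ i)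

/-- Algorithm 4.1 lines 2–7 in the model: the computed `ŝ`. [cite: BlanchardHighamHigham2021, Alg. 4.1] -/
def sHatS (x σ δ ε : ℕ → ℝ) (N : ℕ) : ℝ := flSum (wHatS x σ δ N) ε N

/-- Algorithm 4.1 line 8 in the model: `ŷ = fl(a + fl(log1p(ŝ))) = (a + log(1+ŝ)(1+τ₃))(1+τ₄)`.
[cite: BlanchardHighamHigham2021, Alg. 4.1] -/
def lseHatS (x σ δ ε : ℕ → ℝ) (τ₃ τ₄ : ℝ) (N : ℕ) : ℝ :=
  (x N + Real.log (1 + sHatS x σ δ ε N) * (1 + τ₃)) * (1 + τ₄)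

/-- Algorithm 4.1 lines 9–11 in the model: `ĝⱼ = fl(ŵⱼ / fl(1 + ŝ)) = (ŵⱼ/((1+ŝ)(1+τ₅)))(1+ζⱼ)`
(for `j = N` the numerator is `fl(exp(0))(…) = 1 + δ_N`). [cite: BlanchardHighamHigham2021, Alg. 4.1] -/
def softmaxHatS (x σ δ ε ζ : ℕ → ℝ) (τ₅ : ℝ) (N j : ℕ) : ℝ :=
  wHatS x σ δ N j / ((1 + sHatS x σ δ ε N) * (1 + τ₅)) * (1 + ζ j)

/-- `s ≥ 0`. [cite: BlanchardHighamHigham2021, eq. (4.4)] -/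
theorem shiftSum_nonneg (x : ℕ → ℝ) (N : ℕ) : 0 ≤ shiftSum x N :=
  Finset.sum_nonneg fun _ _ => (Real.exp_pos _).le

/-- `s ≤ n − 1` when `x_N` is maximal. [cite: BlanchardHighamHigham2021, eq. (4.4)] -/
theorem shiftSum_le (x : ℕ → ℝ) {N : ℕ} (hmax : ∀ i < N, x i ≤ x N) : shiftSum x N ≤ N := by
  unfold shiftSum
  calc ∑ i ∈ range N, Real.exp (x i - x N) ≤ ∑ _i ∈ range N, (1 : ℝ) :=
        Finset.sum_le_sum fun i hi => by
          rw [← Real.exp_zero]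
          exact Real.exp_le_exp.mpr (by linarith [hmax i (Finset.mem_range.mp hi)])
    _ = N := by simp

/-- The shifted exponentials sum to `1 + s`. [cite: BlanchardHighamHigham2021, eq. (4.1)] -/
theorem expSum_shift_max (x : ℕ → ℝ) (N : ℕ) :
    expSum (fun i => x i - x N) (N + 1) = 1 + shiftSum x N := by
  show ∑ i ∈ range (N + 1), Real.exp (x i - x N) = 1 + ∑ i ∈ range N, Real.exp (x i - x N)
  rw [Finset.sum_range_succ, sub_self, Real.exp_zero, add_comm]

/-- (4.1): `y = x_max + log(1 + Σ_{i≠k} e^{xᵢ − x_max})`. [cite: BlanchardHighamHigham2021, eq. (4.1)] -/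
theorem lse_eq_max_add_log_one_add (x : ℕ → ℝ) (N : ℕ) :
    lse x (N + 1) = x N + Real.log (1 + shiftSum x N) := by
  rw [lse_shift x (x N) (n := N + 1) (Nat.succ_pos N), lse, expSum_shift_max]

/-- The shifted softmax formula of Algorithm 4.1: `gⱼ = e^{xⱼ − a}/(1 + s)`.
[cite: BlanchardHighamHigham2021, Alg. 4.1] -/
theorem softmax_eq_div_one_add_shiftSum (x : ℕ → ℝ) (N j : ℕ) :
    softmax x (N + 1) j = Real.exp (x j - x N) / (1 + shiftSum x N) := by
  rw [← softmax_shift x (x N) (N + 1) j, softmax, expSum_shift_max]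

/-- `ŵᵢ ≥ 0` (shifted). [cite: BlanchardHighamHigham2021, Alg. 4.1] -/
theorem wHatS_nonneg {u : ℝ} (hu1 : u < 1) (x σ δ : ℕ → ℝ) (hδ : ∀ i, |δ i| ≤ u) (N i : ℕ) :
    0 ≤ wHatS x σ δ N i :=
  mul_nonneg (Real.exp_pos _).le (by have := (abs_le.mp (hδ i)).1; linarith)

/-- (4.5): a shifted term carries `D·u + logErr u`, `D ≥ |xᵢ − a|` (`|(xᵢ − a)σᵢ| ≤ Du` in the
exponent, one unit for the exponential). [cite: BlanchardHighamHigham2021, eq. (4.5)] -/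
theorem logAcc_wHatS {u D : ℝ} (hu1 : u < 1) (x σ δ : ℕ → ℝ) (hσ : ∀ i, |σ i| ≤ u)
    (hδ : ∀ i, |δ i| ≤ u) {N i : ℕ} (hi : |x i - x N| ≤ D) :
    LogAcc (D * u + logErr u) (Real.exp (x i - x N)) (wHatS x σ δ N i) := by
  have hR : |(x i - x N) * (1 + σ i) - (x i - x N)| ≤ D * u := by
    have e : (x i - x N) * (1 + σ i) - (x i - x N) = (x i - x N) * σ i := by ring
    rw [e, abs_mul]
    exact mul_le_mul hi (hσ i) (abs_nonneg _) (le_trans (abs_nonneg _) hi)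
  exact (logAcc_exp_of_abs_sub_le hR).mul_one_add (Real.exp_pos _).le (hδ i) hu1

/-- (4.6)/(4.7) exact: the shifted sum carries `D·u + N·logErr u` (`N = n − 1` loop terms); printed:
`|η| ≤ (n + x_max − x_min)u + O(u²)`. [cite: BlanchardHighamHigham2021, eq. (4.7)] -/
theorem logAcc_sHatS {u D : ℝ} (hu : 0 ≤ u) (hu1 : u < 1) (x σ δ ε : ℕ → ℝ)
    (hσ : ∀ i, |σ i| ≤ u) (hδ : ∀ i, |δ i| ≤ u) (hε : ∀ k, |ε k| ≤ u) {N : ℕ}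
    (hxD : ∀ i < N, |x i - x N| ≤ D) :
    LogAcc (D * u + N * logErr u) (shiftSum x N) (sHatS x σ δ ε N) := by
  rcases Nat.eq_zero_or_pos N with rfl | hN
  · simp [shiftSum, sHatS, flSum, LogAcc]
  · obtain ⟨m, rfl⟩ : ∃ m, N = m + 1 := ⟨N - 1, by omega⟩
    have h1 : LogAcc (D * u + logErr u) (shiftSum x (m + 1))
        (∑ i ∈ range (m + 1), wHatS x σ δ (m + 1) i) :=
      LogAcc.sum _ fun i hi => logAcc_wHatS hu1 x σ δ hσ hδ (hxD i (Finset.mem_range.mp hi))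
    have h2 := logAcc_flSum_succ hu hu1 (wHatS x σ δ (m + 1)) ε
      (wHatS_nonneg hu1 x σ δ hδ (m + 1)) hε m
    exact (h1.trans h2).congr_left (by push_cast; ring)

/-- The `log1p` step of (4.8): if `e^{−L}s ≤ ŝ ≤ e^{L}s` (`s ≥ 0`, `L ≥ 0`) then
`|log(1+ŝ) − log(1+s)| ≤ (s/(1+s))·(e^L − 1)` — the factor `s/(1+s)` is what makes the shifted
algorithm accurate when `s ≪ 1`. [cite: BlanchardHighamHigham2021, eq. (4.8)] -/
theorem abs_log_one_add_sub_log_one_add_le {L s sh : ℝ} (hs : 0 ≤ s)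
    (h : LogAcc L s sh) :
    |Real.log (1 + sh) - Real.log (1 + s)| ≤ s / (1 + s) * (Real.exp L - 1) := by
  have hsh : 0 ≤ sh := h.nonneg hs
  have hlo : Real.exp (-L) * s ≤ sh := h.1
  have hhi : sh ≤ Real.exp L * s := h.2
  generalize hp : Real.exp L = p at hhi ⊢
  generalize hq : Real.exp (-L) = q at hlo
  have hp0 : 0 < p := hp ▸ Real.exp_pos L
  have hq0 : 0 < q := hq ▸ Real.exp_pos (-L)
  have hpq : p * q = 1 := by rw [← hp, ← hq, ← Real.exp_add, add_neg_cancel, Real.exp_zero]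
  have hpq2 : 2 ≤ p + q := by nlinarith [sq_nonneg (p - 1), hp0, hq0, hpq, mul_pos hp0 hq0]
  have h1s : 0 < 1 + s := by linarith
  have h1sh : 0 < 1 + sh := by linarith
  have h1qs : 0 < 1 + q * s := by positivity
  rw [abs_le]
  constructor
  · have h1 : Real.log (1 + s) - Real.log (1 + sh) ≤ (1 + s) / (1 + sh) - 1 := by
      rw [← Real.log_div h1s.ne' h1sh.ne']
      exact Real.log_le_sub_one_of_pos (div_pos h1s h1sh)
    have h2 : (1 + s) / (1 + sh) ≤ (1 + s) / (1 + q * s) :=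
      div_le_div_of_nonneg_left h1s.le h1qs (by linarith)
    have h3 : (1 + s) / (1 + q * s) - 1 ≤ s / (1 + s) * (p - 1) := by
      rw [div_sub_one h1qs.ne', div_mul_eq_mul_div, div_le_div_iff₀ h1qs h1s]
      have e2 : s * (p - 1) * (1 + q * s) = s * (p - 1) + s * s * (p * q) - s * s * q := by ring
      rw [e2, hpq]
      nlinarith [mul_nonneg hs (show (0 : ℝ) ≤ p + q - 2 by linarith)]
    linarith
  · have h1 : Real.log (1 + sh) - Real.log (1 + s) ≤ (1 + sh) / (1 + s) - 1 := by
      rw [← Real.log_div h1sh.ne' h1s.ne']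
      exact Real.log_le_sub_one_of_pos (div_pos h1sh h1s)
    have h2 : (1 + sh) / (1 + s) - 1 = (sh - s) / (1 + s) := by
      rw [div_sub_one h1s.ne']
      congr 1
      ring
    have h3 : (sh - s) / (1 + s) ≤ s / (1 + s) * (p - 1) := by
      rw [div_mul_eq_mul_div]
      have e3 : s * (p - 1) = p * s - s := by ring
      exact div_le_div_of_nonneg_right (by linarith) h1s.le
    linarith

/-- **THEOREM 4.2** (shifted log-sum-exp, Algorithm 4.1), exact form with (4.8) built in:
`|y − ŷ| ≤ u|y| + u(1+u)·log(1+s) + (1+u)²·(s/(1+s))·(e^{Du + N·logErr u} − 1)`, where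
`ŷ = (a + log(1+ŝ)(1+δ₃))(1+δ₄)` — the `u|y|` term is the final addition's `δ₄`, which the source drops.
[cite: BlanchardHighamHigham2021, Thm. 4.2] -/
theorem abs_lse_sub_lseHatS_le {u D : ℝ} (hu : 0 ≤ u) (hu1 : u < 1) (x σ δ ε : ℕ → ℝ)
    {τ₃ τ₄ : ℝ} (hσ : ∀ i, |σ i| ≤ u) (hδ : ∀ i, |δ i| ≤ u) (hε : ∀ k, |ε k| ≤ u)
    (hτ₃ : |τ₃| ≤ u) (hτ₄ : |τ₄| ≤ u) {N : ℕ} (hxD : ∀ i < N, |x i - x N| ≤ D) :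
    |lse x (N + 1) - lseHatS x σ δ ε τ₃ τ₄ N|
      ≤ u * |lse x (N + 1)| + u * (1 + u) * Real.log (1 + shiftSum x N)
        + (1 + u) ^ 2 * (shiftSum x N / (1 + shiftSum x N)
            * (Real.exp (D * u + N * logErr u) - 1)) := by
  have hs0 := shiftSum_nonneg x N
  have hE := abs_log_one_add_sub_log_one_add_le hs0 (logAcc_sHatS hu hu1 x σ δ ε hσ hδ hε hxD)
  have hls0 : 0 ≤ Real.log (1 + shiftSum x N) := Real.log_nonneg (by linarith)
  have key : lse x (N + 1) - lseHatS x σ δ ε τ₃ τ₄ N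
      = -((Real.log (1 + sHatS x σ δ ε N) - Real.log (1 + shiftSum x N))
          + (Real.log (1 + shiftSum x N)
              + (Real.log (1 + sHatS x σ δ ε N) - Real.log (1 + shiftSum x N))) * τ₃
          + (lse x (N + 1)
              + (Real.log (1 + sHatS x σ δ ε N) - Real.log (1 + shiftSum x N)) * (1 + τ₃)
              + Real.log (1 + shiftSum x N) * τ₃) * τ₄) := by
    rw [lseHatS, lse_eq_max_add_log_one_add x N]; ring
  rw [key, abs_neg]
  generalize Real.log (1 + sHatS x σ δ ε N) - Real.log (1 + shiftSum x N) = E at hE ⊢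
  generalize Real.log (1 + shiftSum x N) = ls at hls0 ⊢
  generalize lse x (N + 1) = y
  generalize shiftSum x N / (1 + shiftSum x N) * (Real.exp (D * u + ↑N * logErr u) - 1) = E₁ at hE ⊢
  have hE0 : 0 ≤ E₁ := le_trans (abs_nonneg _) hE
  have h13 : |1 + τ₃| ≤ 1 + u := le_trans (abs_add_le _ _) (by rw [abs_one]; linarith)
  have T1 : |(ls + E) * τ₃| ≤ (ls + E₁) * u := by
    rw [abs_mul]
    refine mul_le_mul ?_ hτ₃ (abs_nonneg _) (by linarith)
    calc |ls + E| ≤ |ls| + |E| := abs_add_le _ _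
      _ ≤ ls + E₁ := by rw [abs_of_nonneg hls0]; linarith
  have T2 : |(y + E * (1 + τ₃) + ls * τ₃) * τ₄| ≤ (|y| + E₁ * (1 + u) + ls * u) * u := by
    rw [abs_mul]
    refine mul_le_mul ?_ hτ₄ (abs_nonneg _)
      (add_nonneg (add_nonneg (abs_nonneg _) (mul_nonneg hE0 (by linarith))) (mul_nonneg hls0 hu))
    calc |y + E * (1 + τ₃) + ls * τ₃| ≤ |y| + |E * (1 + τ₃)| + |ls * τ₃| := abs_add_three _ _ _
      _ = |y| + |E| * |1 + τ₃| + ls * |τ₃| := by rw [abs_mul, abs_mul, abs_of_nonneg hls0]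
      _ ≤ |y| + E₁ * (1 + u) + ls * u := by
          have h1 := mul_le_mul hE h13 (abs_nonneg _) hE0
          have h2 := mul_le_mul_of_nonneg_left hτ₃ hls0
          linarith
  calc |E + (ls + E) * τ₃ + (y + E * (1 + τ₃) + ls * τ₃) * τ₄|
        ≤ |E| + |(ls + E) * τ₃| + |(y + E * (1 + τ₃) + ls * τ₃) * τ₄| := abs_add_three _ _ _
    _ ≤ E₁ + (ls + E₁) * u + (|y| + E₁ * (1 + u) + ls * u) * u := by linarith
    _ = u * |y| + u * (1 + u) * ls + (1 + u) ^ 2 * E₁ := by ring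

/-- **THEOREM 4.2** in the printed shape (4.9)/(4.10): with `log(1+s) = y − x_max` and `s/(1+s) ≤ 1`,
`|y − ŷ| ≤ u|y| + u(1+u)(y − x_max) + (1+u)²(e^{Du + N·logErr u} − 1)
= (|y| + (y − x_max) + D + N)u + O(u²)`, i.e. `(|y| + |y + n − 1 − x_min|)u` at `D = x_max − x_min`;
printed: `|y + n − x_min|u/|y|` relative, `δ₄` ignored. [cite: BlanchardHighamHigham2021, Thm. 4.2 eq. (4.10)] -/
theorem abs_lse_sub_lseHatS_le' {u D : ℝ} (hu : 0 ≤ u) (hu1 : u < 1) (x σ δ ε : ℕ → ℝ)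
    {τ₃ τ₄ : ℝ} (hσ : ∀ i, |σ i| ≤ u) (hδ : ∀ i, |δ i| ≤ u) (hε : ∀ k, |ε k| ≤ u)
    (hτ₃ : |τ₃| ≤ u) (hτ₄ : |τ₄| ≤ u) {N : ℕ} (hxD : ∀ i < N, |x i - x N| ≤ D) (hD : 0 ≤ D) :
    |lse x (N + 1) - lseHatS x σ δ ε τ₃ τ₄ N|
      ≤ u * |lse x (N + 1)| + u * (1 + u) * (lse x (N + 1) - x N)
        + (1 + u) ^ 2 * (Real.exp (D * u + N * logErr u) - 1) := by
  have h := abs_lse_sub_lseHatS_le hu hu1 x σ δ ε hσ hδ hε hτ₃ hτ₄ hxD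
  have hs0 := shiftSum_nonneg x N
  have hy : Real.log (1 + shiftSum x N) = lse x (N + 1) - x N := by
    rw [lse_eq_max_add_log_one_add x N]; ring
  have hL0 : 0 ≤ Real.exp (D * u + N * logErr u) - 1 := by
    have := logErr_nonneg hu hu1
    have h1 : 1 ≤ Real.exp (D * u + N * logErr u) := Real.one_le_exp_iff.mpr (by positivity)
    linarith
  have hfrac : shiftSum x N / (1 + shiftSum x N) ≤ 1 := by
    rw [div_le_one (by linarith)]; linarith
  have h3 : shiftSum x N / (1 + shiftSum x N) * (Real.exp (D * u + N * logErr u) - 1)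
      ≤ Real.exp (D * u + N * logErr u) - 1 := mul_le_of_le_one_left hL0 hfrac
  have h4 := mul_le_mul_of_nonneg_left h3 (show (0 : ℝ) ≤ (1 + u) ^ 2 by positivity)
  rw [hy] at h
  linarith

/-- **THEOREM 4.3** (shifted softmax, Algorithm 4.1), exact form on the log scale: `ĝⱼ` carries
`2Du + (N+3)·logErr u` (numerator `Du + ℓ`; `fl(1+ŝ)`: `Du + Nℓ + ℓ`; division `ℓ`), `j ≤ N`,
`D ≥ 0` any bound with `|xᵢ − x_max| ≤ D`. [cite: BlanchardHighamHigham2021, Thm. 4.3] -/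
theorem logAcc_softmaxHatS {u D : ℝ} (hu : 0 ≤ u) (hu1 : u < 1) (hD : 0 ≤ D) (x σ δ ε ζ : ℕ → ℝ)
    {τ₅ : ℝ} (hσ : ∀ i, |σ i| ≤ u) (hδ : ∀ i, |δ i| ≤ u) (hε : ∀ k, |ε k| ≤ u)
    (hζ : ∀ j, |ζ j| ≤ u) (hτ₅ : |τ₅| ≤ u) {N j : ℕ} (hxD : ∀ i < N, |x i - x N| ≤ D) (hj : j ≤ N) :
    LogAcc (2 * (D * u) + (N + 3) * logErr u) (softmax x (N + 1) j)
      (softmaxHatS x σ δ ε ζ τ₅ N j) := by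
  have hjD : |x j - x N| ≤ D := by
    rcases Nat.lt_or_eq_of_le hj with h | h
    · exact hxD j h
    · rw [h, sub_self, abs_zero]; exact hD
  have hs0 := shiftSum_nonneg x N
  have hL0 : 0 ≤ D * u + N * logErr u := by
    have := logErr_nonneg hu hu1; positivity
  have hnum := logAcc_wHatS hu1 x σ δ hσ hδ hjD
  have hs := logAcc_sHatS hu hu1 x σ δ ε hσ hδ hε hxD
  have hden : LogAcc (D * u + N * logErr u + logErr u) (1 + shiftSum x N)
      ((1 + sHatS x σ δ ε N) * (1 + τ₅)) :=
    ((LogAcc.refl hL0 zero_le_one).add hs).mul_one_add (by linarith) hτ₅ hu1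
  have h := (hnum.div hden (Real.exp_pos _).le (by linarith)).mul_one_add
    (div_nonneg (Real.exp_pos _).le (by linarith)) (hζ j) hu1
  rw [softmax_eq_div_one_add_shiftSum]
  exact h.congr_left (by ring)

/-- **THEOREM 4.3** as an absolute bound: `|ĝⱼ − gⱼ| ≤ (e^{2Du}(1−u)^{−(N+3)} − 1)·gⱼ`
`= (n + 2 + 2D)u·gⱼ + O(u²)` (`n = N + 1`); printed (4.11): `(n + 2 + 2(x_max − x_min))u + O(u²)`.
[cite: BlanchardHighamHigham2021, Thm. 4.3 eq. (4.11)] -/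
theorem abs_softmaxHatS_sub_le {u D : ℝ} (hu : 0 ≤ u) (hu1 : u < 1) (hD : 0 ≤ D)
    (x σ δ ε ζ : ℕ → ℝ) {τ₅ : ℝ} (hσ : ∀ i, |σ i| ≤ u) (hδ : ∀ i, |δ i| ≤ u) (hε : ∀ k, |ε k| ≤ u)
    (hζ : ∀ j, |ζ j| ≤ u) (hτ₅ : |τ₅| ≤ u) {N j : ℕ} (hxD : ∀ i < N, |x i - x N| ≤ D) (hj : j ≤ N) :
    |softmaxHatS x σ δ ε ζ τ₅ N j - softmax x (N + 1) j|
      ≤ (Real.exp (2 * (D * u)) * ((1 - u) ^ (N + 3))⁻¹ - 1) * softmax x (N + 1) j := by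
  have h := (logAcc_softmaxHatS hu hu1 hD x σ δ ε ζ hσ hδ hε hζ hτ₅ hxD hj).abs_sub_le
    (softmax_pos x (Nat.succ_pos N) j).le
  rw [Real.exp_add, show ((N : ℝ) + 3) = ((N + 3 : ℕ) : ℝ) by push_cast; ring,
    exp_natMul_logErr hu1] at h
  exact h

/-- **THEOREM 4.4** (division-free softmax with the shifted `ŷ` of Algorithm 4.1), exact form:
Theorem 3.4's general counter `|xⱼ − y|u + (1+u)|y − ŷ| + logErr u` with Theorem 4.2's bound on
`|y − ŷ|`; first order `(1 + |xⱼ − y| + |y| + (y − x_max) + D + N)u`, printed (4.12):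
`(1 + max|xⱼ − y| + |y + n − x_min|)u + O(u²)`. [cite: BlanchardHighamHigham2021, Thm. 4.4 eq. (4.12)] -/
theorem logAcc_softmaxAltHat_shifted {u D : ℝ} (hu : 0 ≤ u) (hu1 : u < 1) (x σ δ ε κ ν : ℕ → ℝ)
    {τ₃ τ₄ : ℝ} (hσ : ∀ i, |σ i| ≤ u) (hδ : ∀ i, |δ i| ≤ u) (hε : ∀ k, |ε k| ≤ u)
    (hτ₃ : |τ₃| ≤ u) (hτ₄ : |τ₄| ≤ u) {N j : ℕ} (hxD : ∀ i < N, |x i - x N| ≤ D)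
    (hκ : |κ j| ≤ u) (hν : |ν j| ≤ u) :
    LogAcc (|x j - lse x (N + 1)| * u
        + (1 + u) * (u * |lse x (N + 1)| + u * (1 + u) * Real.log (1 + shiftSum x N)
            + (1 + u) ^ 2 * (shiftSum x N / (1 + shiftSum x N)
                * (Real.exp (D * u + N * logErr u) - 1)))
        + logErr u)
      (softmax x (N + 1) j) (softmaxAltHat x κ ν (lseHatS x σ δ ε τ₃ τ₄ N) j) := by
  have h := logAcc_softmaxAltHat hu1 x κ ν (Nat.succ_pos N) hκ hν (lseHatS x σ δ ε τ₃ τ₄ N)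
  refine h.mono ?_ (softmax_pos x (Nat.succ_pos N) j).le
  have hb := abs_lse_sub_lseHatS_le hu hu1 x σ δ ε hσ hδ hε hτ₃ hτ₄ hxD
  have h2 := mul_le_mul_of_nonneg_left hb (show (0 : ℝ) ≤ 1 + u by linarith)
  linarith

end

end Literature.ComputerArithmetic.BlanchardHighamHigham2021
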